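import Mathlib.Analysis.Convex.SimplicialComplex.Basic
import Mathlib.Analysis.Calculus.ContDiff.Defs
import Mathlib.Geometry.Manifold.Instances.Real
import HarnessLib

/-!
# The input of the sweep: a good triangulation of a manifold carrying two smooth structures

Topic `Literature/Topology/FourManifolds`; the bookkeeping structure through which the global
smoothing theorem (Munkres, Ann. of Math. 72 (1960), Thm. 6.2 / Thurston (1997), Thm. 3.10.9: two
smooth structures Whitehead compatible with one PL structure are diffeomorphic) is organised in
this library.  The downward sweep (creases, tubes) is LOCAL: each cell is processed in one triple
of charts, and only needs to see the cells of its star there.  `SweepData n M c₁ c₂` records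
exactly that:

* a family of chart triples `(φ i, e₁ i, e₂ i)`: `φ i` a homeomorphism onto an open set of `ℝⁿ`
  (the PL picture), `e₁ i ∈ atlas c₁`, `e₂ i ∈ atlas c₂`, and a finite geometric simplicial
  complex `K i` in `ℝⁿ` inside `(φ i).target` whose preimage lies in the sources of `e₁ i`, `e₂ i`;
* cells indexed by `κ`, each with an owner chart `owner c` and a simplex `simplex c ∈ K (owner c)`;
  the closed cell is `cell c = (φ (owner c)).symm '' conv (simplex c)`;
* axioms: cells are determined by their closed cell (`inj`), cover `M`, form a locally finite
  family, every cell meeting `cell c` is (in the owner chart of `c`) a simplex of `K (owner c)`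
  (`star_owned`, with the same number of vertices), every simplex of `K (owner c)` touching
  `conv (simplex c)` is a cell of the same dimension (`cell_of_simplex`), `conv (simplex c)` lies in the interior of `|K (owner c)|`
  (`interior_owned`), the complexes are pure of dimension `n` (`pure`), and on every top simplex
  the two maps `e₁ i ∘ (φ i).symm`, `e₂ i ∘ (φ i).symm` have `C^∞` models with injective
  derivative (`model₁`, `model₂`) — the local content of "the triangulation is a smooth
  triangulation of both structures", i.e. of Whitehead compatibility of one PL structure with
  both `c₁` and `c₂` (Munkres (1966), Def. 8.3).

The existence of such data for a PL manifold Whitehead compatible with `c₁` and `c₂` is the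
triangulation theorem of the programme (`G1`); the sweep consumes the structure.  This file has
the structure and its elementary API (`cell`, compactness, intersections of cells are cells of
the owner complex, the star is a neighbourhood).  No named facts; the structure is data.

## References

* J. R. Munkres, *Obstructions to the smoothing of piecewise-differentiable homeomorphisms*, Ann.
  of Math. (2) 72 (1960), 521–554, §5 and Thm. 6.2. [Munkres1960]
* J. R. Munkres, *Elementary differential topology* (1966), Def. 8.3, §10. [Munkres1966]
-/

noncomputable section

open Set Function Filter
open scoped Topology Manifold ContDiff

namespace Literature.Topology.FourManifolds

universe u

/-- Local notation: `𝔼 n` is the model Euclidean space `EuclideanSpace ℝ (Fin n)`. -/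
local notation "𝔼 " n:arg => EuclideanSpace ℝ (Fin n)

/-- **Sweep data**: a good triangulation of `M` relative to the smooth structures `c₁`, `c₂`
(see the module docstring). [folklore] -/
structure SweepData (n : ℕ) (M : Type u) [TopologicalSpace M] (c₁ c₂ : ChartedSpace (𝔼 n) M) where
  /-- index type of the chart triples -/
  ι : Type u
  /-- index type of the cells -/
  κ : Type u
  /-- the PL charts (only their being open partial homeomorphisms is used) -/
  φ : ι → OpenPartialHomeomorph M (𝔼 n)
  /-- the charts of the first smooth structure -/
  e₁ : ι → OpenPartialHomeomorph M (𝔼 n)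
  /-- the charts of the second smooth structure -/
  e₂ : ι → OpenPartialHomeomorph M (𝔼 n)
  mem₁ : ∀ i, e₁ i ∈ @atlas (𝔼 n) _ M _ c₁
  mem₂ : ∀ i, e₂ i ∈ @atlas (𝔼 n) _ M _ c₂
  /-- the finite complexes in PL coordinates -/
  K : ι → Geometry.SimplicialComplex ℝ (𝔼 n)
  finite : ∀ i, (K i).faces.Finite
  space_subset : ∀ i, (K i).space ⊆ (φ i).target
  source₁ : ∀ i, (φ i).symm '' (K i).space ⊆ (e₁ i).source
  source₂ : ∀ i, (φ i).symm '' (K i).space ⊆ (e₂ i).source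
  /-- the owner chart of a cell -/
  owner : κ → ι
  /-- the simplex of a cell in its owner chart -/
  simplex : κ → Finset (𝔼 n)
  simplex_mem : ∀ c, simplex c ∈ (K (owner c)).faces
  /-- cells are determined by their closed cell -/
  inj : ∀ c c', (φ (owner c)).symm '' convexHull ℝ (simplex c : Set (𝔼 n)) =
    (φ (owner c')).symm '' convexHull ℝ (simplex c' : Set (𝔼 n)) → c = c'
  /-- the closed cells cover `M` -/
  cover : ∀ p : M, ∃ c, p ∈ (φ (owner c)).symm '' convexHull ℝ (simplex c : Set (𝔼 n))
  /-- the closed cells form a locally finite family -/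
  locallyFinite : LocallyFinite fun c => (φ (owner c)).symm '' convexHull ℝ (simplex c : Set (𝔼 n))
  /-- every cell meeting `cell c` is, in the owner chart of `c`, a simplex of `K (owner c)` -/
  star_owned : ∀ c c',
    ((φ (owner c)).symm '' convexHull ℝ (simplex c : Set (𝔼 n)) ∩
      (φ (owner c')).symm '' convexHull ℝ (simplex c' : Set (𝔼 n))).Nonempty →
    ∃ s' ∈ (K (owner c)).faces, s'.card = (simplex c').card ∧
      (φ (owner c')).symm '' convexHull ℝ (simplex c' : Set (𝔼 n)) =
        (φ (owner c)).symm '' convexHull ℝ (s' : Set (𝔼 n))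
  /-- every simplex of `K (owner c)` touching `conv (simplex c)` is a cell (of the same
  dimension) -/
  cell_of_simplex : ∀ c, ∀ t ∈ (K (owner c)).faces,
    (convexHull ℝ (t : Set (𝔼 n)) ∩ convexHull ℝ (simplex c : Set (𝔼 n))).Nonempty →
    ∃ c', (simplex c').card = t.card ∧
      (φ (owner c')).symm '' convexHull ℝ (simplex c' : Set (𝔼 n)) =
        (φ (owner c)).symm '' convexHull ℝ (t : Set (𝔼 n))
  /-- the owner complex is a neighbourhood of the owned cell -/
  interior_owned : ∀ c, convexHull ℝ (simplex c : Set (𝔼 n)) ⊆ interior (K (owner c)).space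
  /-- the complexes are pure of dimension `n` -/
  pure : ∀ i, ∀ s ∈ (K i).faces, ∃ t ∈ (K i).faces, s ⊆ t ∧ t.card = n + 1
  /-- smooth models of the first PD chart on top simplices -/
  model₁ : ∀ i, ∀ t ∈ (K i).faces, t.card = n + 1 → ∃ g : 𝔼 n → 𝔼 n, ContDiff ℝ ∞ g ∧
    EqOn (e₁ i ∘ (φ i).symm) g (convexHull ℝ (t : Set (𝔼 n))) ∧
    ∀ x ∈ convexHull ℝ (t : Set (𝔼 n)), Injective (fderiv ℝ g x)
  /-- smooth models of the second PD chart on top simplices -/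
  model₂ : ∀ i, ∀ t ∈ (K i).faces, t.card = n + 1 → ∃ g : 𝔼 n → 𝔼 n, ContDiff ℝ ∞ g ∧
    EqOn (e₂ i ∘ (φ i).symm) g (convexHull ℝ (t : Set (𝔼 n))) ∧
    ∀ x ∈ convexHull ℝ (t : Set (𝔼 n)), Injective (fderiv ℝ g x)

namespace SweepData

variable {n : ℕ} {M : Type u} [TopologicalSpace M] {c₁ c₂ : ChartedSpace (𝔼 n) M}
variable (S : SweepData n M c₁ c₂)

/-- The closed simplex of a cell in its owner chart. [folklore] -/
def hull (c : S.κ) : Set (𝔼 n) := convexHull ℝ (S.simplex c : Set (𝔼 n))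

/-- **The closed cell** of `c`: the preimage under the owner chart of its closed simplex.
[folklore] -/
def cell (c : S.κ) : Set M := (S.φ (S.owner c)).symm '' S.hull c

/-- Unfolding `cell`. [folklore] -/
theorem cell_eq (c : S.κ) :
    S.cell c = (S.φ (S.owner c)).symm '' convexHull ℝ (S.simplex c : Set (𝔼 n)) := rfl

/-- The closed simplex of a cell lies in the owner complex. [folklore] -/
theorem hull_subset_space (c : S.κ) : S.hull c ⊆ (S.K (S.owner c)).space :=
  (S.K (S.owner c)).convexHull_subset_space (S.simplex_mem c)

/-- The closed simplex of a cell lies in the owner chart's target. [folklore] -/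
theorem hull_subset_target (c : S.κ) : S.hull c ⊆ (S.φ (S.owner c)).target :=
  (S.hull_subset_space c).trans (S.space_subset _)

/-- The closed simplex of a cell is compact. [folklore] -/
theorem isCompact_hull (c : S.κ) : IsCompact (S.hull c) := by
  show IsCompact (convexHull ℝ (S.simplex c : Set (𝔼 n)))
  exact (S.simplex c).finite_toSet.isCompact_convexHull ℝ

/-- **Closed cells are compact.** [folklore] -/
theorem isCompact_cell (c : S.κ) : IsCompact (S.cell c) :=
  (S.isCompact_hull c).image_of_continuousOn
    ((S.φ (S.owner c)).continuousOn_symm.mono (S.hull_subset_target c))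

/-- Closed cells are closed (in a Hausdorff `M`). [folklore] -/
theorem isClosed_cell [T2Space M] (c : S.κ) : IsClosed (S.cell c) := (S.isCompact_cell c).isClosed

/-- The closed cells cover `M`. [folklore] -/
theorem exists_mem_cell (p : M) : ∃ c, p ∈ S.cell c := S.cover p

/-- The closed cells form a locally finite family. [folklore] -/
theorem locallyFinite_cell : LocallyFinite S.cell := S.locallyFinite

/-- The cells owned... every cell meeting `cell c` is an owner-chart simplex. [folklore] -/
theorem exists_eq_image_of_inter_nonempty {c c' : S.κ} (h : (S.cell c ∩ S.cell c').Nonempty) :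
    ∃ s' ∈ (S.K (S.owner c)).faces, s'.card = (S.simplex c').card ∧
      S.cell c' = (S.φ (S.owner c)).symm '' convexHull ℝ (s' : Set (𝔼 n)) :=
  S.star_owned c c' h

/-- Every simplex of the owner complex touching the simplex of `c` is the cell of some cell index
of the same dimension. [folklore] -/
theorem exists_cell_eq_of_inter_nonempty (c : S.κ) {t : Finset (𝔼 n)} (ht : t ∈ (S.K (S.owner c)).faces)
    (h : (convexHull ℝ (t : Set (𝔼 n)) ∩ S.hull c).Nonempty) :
    ∃ c', (S.simplex c').card = t.card ∧
      S.cell c' = (S.φ (S.owner c)).symm '' convexHull ℝ (t : Set (𝔼 n)) :=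
  S.cell_of_simplex c t ht h

/-- A closed cell lies in the source of both smooth charts of its owner. [folklore] -/
theorem cell_subset_source₁ (c : S.κ) : S.cell c ⊆ (S.e₁ (S.owner c)).source :=
  (image_mono (S.hull_subset_space c)).trans (S.source₁ _)

/-- A closed cell lies in the source of the second smooth chart of its owner. [folklore] -/
theorem cell_subset_source₂ (c : S.κ) : S.cell c ⊆ (S.e₂ (S.owner c)).source :=
  (image_mono (S.hull_subset_space c)).trans (S.source₂ _)

/-- A closed cell lies in the source of its owner's PL chart. [folklore] -/
theorem cell_subset_source (c : S.κ) : S.cell c ⊆ (S.φ (S.owner c)).source := by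
  rintro _ ⟨x, hx, rfl⟩
  exact (S.φ (S.owner c)).map_target (S.hull_subset_target c hx)

/-- The owner chart maps the closed cell onto the closed simplex. [folklore] -/
theorem image_cell (c : S.κ) : S.φ (S.owner c) '' S.cell c = S.hull c := by
  rw [cell, image_image]
  refine (image_congr (g := fun x => x) fun x hx => ?_).trans (image_id' _)
  exact (S.φ (S.owner c)).right_inv (S.hull_subset_target c hx)

/-- **The open star is a neighbourhood**: the preimage under the owner chart of the interior of
`|K (owner c)|` is an open set of `M` containing `cell c`. [folklore] -/
theorem cell_subset_symm_image_interior (c : S.κ) :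
    S.cell c ⊆ (S.φ (S.owner c)).symm '' interior (S.K (S.owner c)).space :=
  image_mono (S.interior_owned c)

/-- The preimage of the interior of the owner complex is open. [folklore] -/
theorem isOpen_symm_image_interior (i : S.ι) :
    IsOpen ((S.φ i).symm '' interior (S.K i).space) :=
  (S.φ i).symm.isOpen_image_of_subset_source isOpen_interior
    (interior_subset.trans (by rw [(S.φ i).symm_source]; exact S.space_subset i))

/-- **The intersection of two meeting cells is a cell of the owner complex**: if `cell c'` meets
`cell c`, with `cell c' = φ.symm '' conv s'` (`star_owned`), then
`cell c ∩ cell c' = φ.symm '' conv (simplex c ∩ s')` (the complex axiom). [folklore] -/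
theorem cell_inter_eq {c c' : S.κ} {s' : Finset (𝔼 n)} (hs' : s' ∈ (S.K (S.owner c)).faces)
    (heq : S.cell c' = (S.φ (S.owner c)).symm '' convexHull ℝ (s' : Set (𝔼 n))) :
    S.cell c ∩ S.cell c' =
      (S.φ (S.owner c)).symm '' convexHull ℝ ((S.simplex c ∩ s' : Finset (𝔼 n)) : Set (𝔼 n)) := by
  classical
  set φ := S.φ (S.owner c) with hφ
  have hinj : InjOn φ.symm φ.target := φ.symm.injOn
  have h1 : S.hull c ⊆ φ.target := S.hull_subset_target c
  have h2 : convexHull ℝ (s' : Set (𝔼 n)) ⊆ φ.target :=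
    ((S.K (S.owner c)).convexHull_subset_space hs').trans (S.space_subset _)
  rw [heq, cell, ← hinj.image_inter h1 h2, Finset.coe_inter,
    ← Geometry.SimplicialComplex.convexHull_inter_convexHull (S.simplex_mem c) hs']
  rfl

end SweepData

end Literature.Topology.FourManifolds
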